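import Summits.BirchSwinnertonDyer.BirchSwinnertonDyer.Theorems.GoldfeldAllTwistsTwoConverseTwinBirchLemmaKrizLi7EvenDiscr
import Summits.BirchSwinnertonDyer.BirchSwinnertonDyer.Theorems.GoldfeldAllTwistsTwoConverseTwinBirchLocalFive
import Summits.BirchSwinnertonDyer.BirchSwinnertonDyer.Theorems.GoldfeldAllTwistsTwoConverseTwinBirchLocalTen
import Summits.BirchSwinnertonDyer.BirchSwinnertonDyer.Theorems.GoldfeldAllTwistsTwoConverseTwinGenusDescentMinimal
import HarnessLib

set_option linter.dupNamespace false
set_option autoImplicit false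

/-!
# Crux `PrintCf2.SplitBadTwoRankOneOfFacts` (stmt-BirchSwinnertonDyer-20368), road α = line `rubin_value_two` (parent skeleton
# of record v5, LEAD g8), stub `stub_anchor_two_kit`: the ANCHORS `d₀ = −5` (2-adic key (1,3)) and `d₀ = −10` (key (0,3)),
# kernel part (a) — `49a1^{(−5)}` (`N = 19600`) and `49a1^{(−10)}` (`N = 78400`) have the global minimal models
# `[0, −105, 0, 2800, 0]`, `[0, −210, 0, 11200, 0]`, Mordell–Weil rank EXACTLY `1` and `Ш[2] = 0`, UNCONDITIONALLY

Cell `bsd-print-cf2`, width seat `bsd-line-cf2-p1-w3` g3 (`--supports stmt-BirchSwinnertonDyer-20368`). HONEST FRAMING: theorems about TWO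
explicit elliptic curves over `ℚ`; no BSD statement is proved. The line card (`Lines/rubin-value-two.md` § «Anchor supply», critic V#58
P5) asks per remaining 2-adic key of S4b for «(a) a Theorems file proving the minimal model, `C₀ • W₀ = cm7.quadraticTwist d₀`,
`mordellWeilRank = 1`, `Ш[2] = 0`» and «(b) a certified analytic datum `r_an = 1 ∧ BSD(W₀, 2)`». This file is (a) for the two keys
whose anchors are INERT(-PRIME) twists — `d₀ = −5 = −m` and `d₀ = −10 = −2m` with `m = 5 ≡ 1 (mod 4)` inert in `ℚ(√−7)` — where cell
bsd-goldfeld's complete `2`-isogeny descents `rank_le_one_and_sha_two_inertTwist` / `…_inertTwoTwist` apply; the keys (0,5), (0,1)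
(anchors `−6 = −2·3`, `−30`: the prime `3 ≢ 1 (mod 4)`) are NOT reached by those descents and are not treated. For (b) it records
what the tree already gives BY NAME: `r_an = 1` for every model of `49a1^{(−5)}` / `49a1^{(−10)}` GRANTED Kriz–Li 2019 Thm. 1.20,
Modularity, CLTZ 2015 Thm. 1.2, Gross–Zagier and Heegner rationality (bsd-goldfeld `analyticRank_eq_one_twist_cm7_neg5 / _neg10`, the
Bernoulli certificates being kernel theorems), whence — with GZK — `Ш[2^∞] = 0`, `corank Sel_{2^∞} = 1` and
**`BSD(W₀, 2) ⟺ ord₂ #Ш_an(W₀) = 0`**: the residual numeric datum of each anchor is exactly the `2`-adic unit certificate of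
`#Ш_an = L′(E,1)·#tors²/(Ω·Reg·∏c_ℓ)` (Miller 2011 style), nothing else.

HOW (template = bsd-goldfeld's `…TwinGenusDescent{,Minimal}.lean` for `d₀ = −1, −2`; the models, their `2`-adic minimality and invariants
`c₄, c₆` are REUSED from `…TwinBirchLocalFive/Ten.lean`). Lower bounds by explicit points of infinite order via Silverman–Tate's `α`:
`P₅ = (50, 50)` on `E₅ : y² = x³ − 105x² + 2800x` (`α = [50] = [2] ∉ {1, [2800] = [7]}`, `a² − 4b = −175`), and `P₁₀ = (50, 400)` on
`E₁₀ : y² = x³ − 210x² + 11200x` (`50³ − 210·50² + 11200·50 = 160000 = 400²`; `α = [2] ∉ {1, [11200] = [7]}`, `a² − 4b = −700`).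
Global minimality: Kraus at `2` (bsd-goldfeld) + `p¹² ∤ Δ` at odd `p` (`Δ(E₅) = −2¹²·5⁶·7³`, `Δ(E₁₀) = −2¹⁸·5⁶·7³`).
BSD is not proved by any of this; no summit statement is proved by this seat.

References: [SilvermanTate2015] §3.5; [SilvermanAEC2009] III.1, VII.1 Rem. 1.1, VIII.6.7, X.4.2, X.4.9; [Kraus1989] Prop. 2; [KrizLi2019]
Thm. 1.20; [Miller2011LMS] Def. 1.1.
-/

noncomputable section

open scoped Classical

open WeierstrassCurve Literature.NumberTheory.EllipticCurves Literature.NumberTheory.EllipticCurves.ModularForms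
  Literature.NumberTheory.EllipticCurves.KrizLi2019
  Summit.BirchSwinnertonDyer.BirchSwinnertonDyer.Theorems.GoldfeldGoodTwists

namespace Summit.BirchSwinnertonDyer.BirchSwinnertonDyer.Theorems.PrintCf2.RubinValueTwoAnchor

/-! ## §1 Anchor `d₀ = −5`: `E₅ = [0, −105, 0, 2800, 0]` (`49a1^{(−5)}`, `N = 19600`) -/

/-- `E₅` is the `m = 5` instance of bsd-goldfeld's inert-twist model `[0, −21m, 0, 112m², 0]`. [folklore] -/
theorem E5_eq_inertTwist_five : (⟨0, -105, 0, 2800, 0⟩ : WeierstrassCurve ℚ) =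
    (⟨0, ((-21 * (5 : ℕ) : ℤ) : ℚ), 0, ((112 * (5 : ℕ) ^ 2 : ℤ) : ℚ), 0⟩ : WeierstrassCurve ℚ) := by
  ext <;> push_cast <;> norm_num

/-- The point `P₅ = (50, 50)` lies on `E₅`: `50³ − 105·50² + 2800·50 = 2500 = 50²`. [folklore] -/
theorem nonsingular_E5_fifty : (⟨0, -105, 0, 2800, 0⟩ : WeierstrassCurve ℚ).toAffine.Nonsingular 50 50 := by
  haveI := isElliptic_twoTorsionModel_neg_five
  refine (Affine.equation_iff_nonsingular).mp ?_
  rw [Affine.equation_iff']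
  norm_num

/-- `−175, 2800, 50, 140000` are not squares in `ℚ` (`−175 < 0`; `52² < 2800 < 53²`; `7² < 50 < 8²`; `374² < 140000 < 375²`). [folklore] -/
theorem not_isSquare_rat_anchor5 :
    ¬ IsSquare (-175 : ℚ) ∧ ¬ IsSquare (2800 : ℚ) ∧ ¬ IsSquare (50 : ℚ) ∧ ¬ IsSquare (140000 : ℚ) := by
  refine ⟨?_, ?_, ?_, ?_⟩
  · rw [show (-175 : ℚ) = ((-175 : ℤ) : ℚ) by norm_num, Rat.isSquare_intCast_iff]
    rintro ⟨r, hr⟩; nlinarith [mul_self_nonneg r]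
  · rw [show (2800 : ℚ) = ((2800 : ℕ) : ℚ) by norm_num, Rat.isSquare_natCast_iff]
    rintro ⟨r, hr⟩; exact Nat.not_exists_sq (m := 52) (by norm_num) (by norm_num) ⟨r, hr.symm⟩
  · rw [show (50 : ℚ) = ((50 : ℕ) : ℚ) by norm_num, Rat.isSquare_natCast_iff]
    rintro ⟨r, hr⟩; exact Nat.not_exists_sq (m := 7) (by norm_num) (by norm_num) ⟨r, hr.symm⟩
  · rw [show (140000 : ℚ) = ((140000 : ℕ) : ℚ) by norm_num, Rat.isSquare_natCast_iff]
    rintro ⟨r, hr⟩; exact Nat.not_exists_sq (m := 374) (by norm_num) (by norm_num) ⟨r, hr.symm⟩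

/-- **`P₅ = (50, 50) ∉ 2E₅(ℚ) + E₅(ℚ)_tors`** (Silverman–Tate `α(P₅) = [50] ∉ {1, [2800]}`, `a² − 4b = −175` and `b = 2800`
non-squares; `some_ne_two_zsmul_add_of_not_isSquare`). [cite: SilvermanTate2015, §3.5] -/
theorem fifty_ne_two_zsmul_add_E5 (R t : (⟨0, -105, 0, 2800, 0⟩ : WeierstrassCurve ℚ).toAffine.Point)
    (ht : IsOfFinAddOrder t) : Affine.Point.some 50 50 nonsingular_E5_fifty ≠ (2 : ℤ) • R + t := by
  haveI := isElliptic_twoTorsionModel_neg_five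
  haveI : (⟨0, -105, 0, 2800, 0⟩ : WeierstrassCurve ℚ).IsTwoTorsionNF := ⟨rfl, rfl, rfl⟩
  obtain ⟨hD, hb, h50, h140⟩ := not_isSquare_rat_anchor5
  have hD' : ¬ IsSquare ((⟨0, -105, 0, 2800, 0⟩ : WeierstrassCurve ℚ).a₂ ^ 2 -
      4 * (⟨0, -105, 0, 2800, 0⟩ : WeierstrassCurve ℚ).a₄) := by
    rw [show (⟨0, -105, 0, 2800, 0⟩ : WeierstrassCurve ℚ).a₂ ^ 2 - 4 * (⟨0, -105, 0, 2800, 0⟩ : WeierstrassCurve ℚ).a₄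
      = -175 by norm_num]; exact hD
  have h₂ : ¬ IsSquare ((50 : ℚ) * (⟨0, -105, 0, 2800, 0⟩ : WeierstrassCurve ℚ).a₄) := by
    rw [show (50 : ℚ) * (⟨0, -105, 0, 2800, 0⟩ : WeierstrassCurve ℚ).a₄ = 140000 by norm_num]; exact h140
  have h := some_ne_two_zsmul_add_of_not_isSquare _ hD' hb nonsingular_E5_fifty (by norm_num) h50 h₂ R t
    (by convert ht)
  convert h

/-- **`P₅` has infinite order in `E₅(ℚ)`.** [cite: SilvermanTate2015, §3.5] -/
theorem not_isOfFinAddOrder_fifty_E5 : ¬ IsOfFinAddOrder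
    (Affine.Point.some 50 50 nonsingular_E5_fifty : (⟨0, -105, 0, 2800, 0⟩ : WeierstrassCurve ℚ).toAffine.Point) := by
  intro hfin
  exact fifty_ne_two_zsmul_add_E5 0 _ hfin (by rw [zsmul_zero, zero_add])

/-- `5` is squarefree, `≡ 1 (mod 4)` and inert in `ℚ(√−7)` (`−7 ≡ 3` is not a square mod `5`), in the shape the inert-twist
descents consume. [folklore] -/
theorem inert_five : 0 < 5 ∧ Squarefree (5 : ℕ) ∧
    ∀ l : ℕ, l.Prime → l ∣ 5 → l % 4 = 1 ∧ ¬ IsSquare ((-7 : ℤ) : ZMod l) := by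
  refine ⟨by norm_num, Nat.prime_five.squarefree, fun l hl hl5 => ?_⟩
  have hl' : l = 5 := (Nat.prime_dvd_prime_iff_eq hl (by norm_num)).mp hl5
  subst hl'
  exact ⟨by norm_num, by decide⟩

/-- **`rank E₅(ℚ) ≤ 1`, and `= 1 ⇒ Ш(E₅/ℚ)[2] = 0`** (bsd-goldfeld's complete `2`-isogeny descent
`rank_le_one_and_sha_two_twoTorsionModel_inertTwist` at `m = 5`). [cite: SilvermanAEC2009, Thm. X.4.2(a), Prop. X.4.9] -/
theorem rank_le_one_and_sha_two_E5 :
    haveI := isElliptic_twoTorsionModel_neg_five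
    (⟨0, -105, 0, 2800, 0⟩ : WeierstrassCurve ℚ).mordellWeilRank ≤ 1 ∧
      ((⟨0, -105, 0, 2800, 0⟩ : WeierstrassCurve ℚ).mordellWeilRank = 1 →
        ∀ c ∈ (⟨0, -105, 0, 2800, 0⟩ : WeierstrassCurve ℚ).sha, 2 • c = 0 → c = 0) := by
  haveI := isElliptic_twoTorsionModel_neg_five
  obtain ⟨h0, hsq, hinert⟩ := inert_five
  haveI : (⟨0, ((-21 * (5 : ℕ) : ℤ) : ℚ), 0, ((112 * (5 : ℕ) ^ 2 : ℤ) : ℚ), 0⟩ : WeierstrassCurve ℚ).IsElliptic := by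
    rw [← E5_eq_inertTwist_five]; exact isElliptic_twoTorsionModel_neg_five
  have h := rank_le_one_and_sha_two_twoTorsionModel_inertTwist (m := 5) h0 hsq hinert
  rw [← E5_eq_inertTwist_five] at h
  exact h

/-- **`rank E₅(ℚ) = 1`**, UNCONDITIONAL (`≤ 1` by descent, `≥ 1` by `P₅` and Mordell–Weil). [cite: SilvermanAEC2009, Thm. VIII.6.7, Thm. X.4.2(a)] -/
theorem mordellWeilRank_E5 :
    haveI := isElliptic_twoTorsionModel_neg_five
    (⟨0, -105, 0, 2800, 0⟩ : WeierstrassCurve ℚ).mordellWeilRank = 1 := by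
  haveI := isElliptic_twoTorsionModel_neg_five
  refine le_antisymm rank_le_one_and_sha_two_E5.1 ?_
  refine one_le_mordellWeilRank_of_not_isOfFinAddOrder_rat _ (P := Affine.Point.some 50 50 nonsingular_E5_fifty) ?_
  convert not_isOfFinAddOrder_fifty_E5

/-- **`Ш(E₅/ℚ)[2] = 0`**, UNCONDITIONAL. [cite: SilvermanAEC2009, Thm. X.4.2(a), Prop. X.4.9] -/
theorem forall_mem_sha_two_E5 :
    haveI := isElliptic_twoTorsionModel_neg_five
    ∀ c ∈ (⟨0, -105, 0, 2800, 0⟩ : WeierstrassCurve ℚ).sha, 2 • c = 0 → c = 0 :=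
  rank_le_one_and_sha_two_E5.2 mordellWeilRank_E5

/-- `Δ(E₅) = −21952000000 = −2¹²·5⁶·7³` (kernel computation; `c₄ = 2⁴·2625`, `c₆ = 64·(−165375)` are bsd-goldfeld's
`invariants_twoTorsionModel_neg_five`). [folklore] -/
theorem Δ_E5_int : (⟨0, -105, 0, 2800, 0⟩ : WeierstrassCurve ℤ).Δ = -21952000000 := by decide

/-- `p¹² ∤ N` for an odd prime `p` and `N ∈ {2¹²·5⁶·7³, 2¹⁸·5⁶·7³}` (`N < 16¹²`, so `p < 16`; then case by case). [folklore] -/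
theorem not_pow_twelve_dvd_of_odd_prime' {p : ℕ} (hp : p.Prime) (hp2 : p ≠ 2) {N : ℤ}
    (hN : N = -21952000000 ∨ N = -1404928000000) : ¬ (p : ℤ) ^ 12 ∣ N := by
  intro h
  have h' : p ^ 12 ∣ N.natAbs := by
    have := Int.natAbs_dvd_natAbs.mpr h
    simpa [Int.natAbs_pow] using this
  have hpos : 0 < N.natAbs := by rcases hN with rfl | rfl <;> decide
  have hle : p ^ 12 ≤ N.natAbs := Nat.le_of_dvd hpos h'
  have hlt : N.natAbs < 16 ^ 12 := by rcases hN with rfl | rfl <;> decide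
  have hp16 : p < 16 := by
    by_contra hge
    have : 16 ^ 12 ≤ p ^ 12 := Nat.pow_le_pow_left (not_lt.mp hge) 12
    omega
  have h2 := hp.two_le
  rcases hN with rfl | rfl <;> interval_cases p <;> simp_all (config := {decide := true})

/-- **`E₅ = [0, −105, 0, 2800, 0]` is a GLOBAL MINIMAL MODEL** (Kraus at `2`: `2⁸ ∤ c₄`, `c₆ = 64·(−165375)` with `4 ∤ −165374`;
`ord_p Δ < 12` at odd `p`). [cite: Kraus1989, Prop. 2] [cite: SilvermanAEC2009, VII.1 Remark 1.1] -/
theorem isGloballyMinimal_E5 : (⟨0, -105, 0, 2800, 0⟩ : WeierstrassCurve ℚ).IsGloballyMinimal := by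
  obtain ⟨h4, h6⟩ := invariants_twoTorsionModel_neg_five
  rw [twoTorsionModel_neg_five_eq_baseChange]
  exact isGloballyMinimal_baseChange_int_of_kraus _ (by rw [h4]; decide) h6 (by decide)
    (fun p hp hp2 ↦ by rw [Δ_E5_int]; exact not_pow_twelve_dvd_of_odd_prime' hp hp2 (Or.inl rfl))

/-- **`E₅` is a model of `cm7^{(−5)}`**: `∃ C₀, C₀ • E₅ = cm7.quadraticTwist (−5)` (inverse of bsd-goldfeld's two-torsion change).
[cite: SilvermanAEC2009, III.1 Table 3.1] -/
theorem exists_smul_E5_eq_cm7_quadraticTwist_neg_five :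
    ∃ C₀ : VariableChange ℚ, C₀ • (⟨0, -105, 0, 2800, 0⟩ : WeierstrassCurve ℚ) = cm7.quadraticTwist ((-5 : ℤ) : ℚ) :=
  ⟨(⟨(Units.mk0 (2 : ℚ) two_ne_zero)⁻¹, -10, 0, 0⟩ : VariableChange ℚ)⁻¹, by
    rw [← twoTorsionChange_smul_cm7_quadraticTwist_neg_five, inv_smul_smul]; norm_num⟩

/-- **ANCHOR `d₀ = −5`, PART (a), assembled** (UNCONDITIONAL): `E₅` is a globally minimal model of `cm7^{(−5)}` with rank exactly
`1` and `Ш[2] = 0`. [cite: SilvermanAEC2009, Thm. VIII.6.7, Thm. X.4.2(a)] [cite: Kraus1989, Prop. 2] -/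
theorem anchor_neg_five_partA :
    haveI := isElliptic_twoTorsionModel_neg_five
    (⟨0, -105, 0, 2800, 0⟩ : WeierstrassCurve ℚ).IsGloballyMinimal ∧
      (∃ C₀ : VariableChange ℚ, C₀ • (⟨0, -105, 0, 2800, 0⟩ : WeierstrassCurve ℚ) = cm7.quadraticTwist ((-5 : ℤ) : ℚ)) ∧
      (⟨0, -105, 0, 2800, 0⟩ : WeierstrassCurve ℚ).mordellWeilRank = 1 ∧
      (∀ c ∈ (⟨0, -105, 0, 2800, 0⟩ : WeierstrassCurve ℚ).sha, 2 • c = 0 → c = 0) :=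
  ⟨isGloballyMinimal_E5, exists_smul_E5_eq_cm7_quadraticTwist_neg_five, mordellWeilRank_E5, forall_mem_sha_two_E5⟩

/-- **ANCHOR `d₀ = −5`, the shape of PART (b).** GRANTED Kriz–Li 2019 Thm. 1.20 (`h120`), Modularity (`hnf`), CLTZ 2015 Thm. 1.2
(`h12`), Gross–Zagier (`hGZ`), Heegner rationality (`hHP`) and GZK (`hGZK`): `r_an(E₅) = 1` (bsd-goldfeld
`analyticRank_eq_one_twist_cm7_neg5`), `Ш(E₅)[2^∞] = 0`, `corank_{ℤ₂} Sel_{2^∞}(E₅) = 1`, and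
**`BSD(E₅, 2) ⟺ ∃ q : ℚ, #Ш_an(E₅) = q ∧ ord₂ q = 0`** — the anchor's residual datum is the `2`-adic unit certificate of `#Ш_an`.
[cite: KrizLi2019, Thm. 1.20 (pp. 7–8)] [cite: Miller2011LMS, Def. 1.1] [cite: SilvermanAEC2009, Thm. X.4.2(a), Prop. X.4.9] -/
theorem anchor_neg_five_partB_shape (h120 : thm120_padicLogHeegner_unit_of_bernoulli)
    (hnf : exists_isNewformOf) (h12 : CoatesLiTianZhai2015.thm12_fullBSD_twist)
    (hGZ : ∀ (N : ℕ) [NeZero N] (W : WeierstrassCurve ℚ) (K : Type) [Field K] [NumberField K], gross_zagier N W K)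
    (hHP : ∀ (W : WeierstrassCurve ℚ) (K : Type) [Field K] [NumberField K], exists_isHeegnerPoint W K)
    (hGZK : rank_eq_analyticRank_of_analyticRank_le_one) :
    haveI := isElliptic_twoTorsionModel_neg_five
    (⟨0, -105, 0, 2800, 0⟩ : WeierstrassCurve ℚ).analyticRank = 1 ∧
      AddCommGroup.primaryComponent (⟨0, -105, 0, 2800, 0⟩ : WeierstrassCurve ℚ).sha 2 = ⊥ ∧
      (⟨0, -105, 0, 2800, 0⟩ : WeierstrassCurve ℚ).selmerCorank 2 = 1 ∧
      (BSDp (⟨0, -105, 0, 2800, 0⟩ : WeierstrassCurve ℚ) 2 ↔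
        ∃ q : ℚ, shaAn (⟨0, -105, 0, 2800, 0⟩ : WeierstrassCurve ℚ) = (q : ℂ) ∧ padicValRat 2 q = 0) := by
  haveI := isElliptic_twoTorsionModel_neg_five
  obtain ⟨C₀, hC₀⟩ := exists_smul_E5_eq_cm7_quadraticTwist_neg_five
  have har := analyticRank_eq_one_twist_cm7_neg5 h120 hnf h12 hGZ hHP _ C₀ (by rw [hC₀]; norm_num)
  obtain ⟨h0, hsq, hinert⟩ := inert_five
  obtain ⟨-, hbot, hcork, hiff⟩ := bsdp_two_iff_shaAn_unit_inertTwist hGZK (m := 5) h0 hsq hinert _ C₀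
    (by rw [hC₀]; norm_num) har
  exact ⟨har, hbot, hcork, hiff⟩

/-! ## §2 Anchor `d₀ = −10`: `E₁₀ = [0, −210, 0, 11200, 0]` (`49a1^{(−10)}`, `N = 78400`) -/

/-- `E₁₀` is the `m = 5` instance of bsd-goldfeld's inert-two-twist model `[0, −42m, 0, 448m², 0]`. [folklore] -/
theorem E10_eq_inertTwoTwist_five : (⟨0, -210, 0, 11200, 0⟩ : WeierstrassCurve ℚ) =
    (⟨0, ((-42 * (5 : ℕ) : ℤ) : ℚ), 0, ((448 * (5 : ℕ) ^ 2 : ℤ) : ℚ), 0⟩ : WeierstrassCurve ℚ) := by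
  ext <;> push_cast <;> norm_num

/-- The point `P₁₀ = (50, 400)` lies on `E₁₀`: `50³ − 210·50² + 11200·50 = 160000 = 400²`. [folklore] -/
theorem nonsingular_E10_fifty : (⟨0, -210, 0, 11200, 0⟩ : WeierstrassCurve ℚ).toAffine.Nonsingular 50 400 := by
  haveI := isElliptic_twoTorsionModel_neg_ten
  refine (Affine.equation_iff_nonsingular).mp ?_
  rw [Affine.equation_iff']
  norm_num

/-- `−700, 11200, 560000` are not squares in `ℚ` (`−700 < 0`; `105² < 11200 < 106²`; `748² < 560000 < 749²`). [folklore] -/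
theorem not_isSquare_rat_anchor10 :
    ¬ IsSquare (-700 : ℚ) ∧ ¬ IsSquare (11200 : ℚ) ∧ ¬ IsSquare (560000 : ℚ) := by
  refine ⟨?_, ?_, ?_⟩
  · rw [show (-700 : ℚ) = ((-700 : ℤ) : ℚ) by norm_num, Rat.isSquare_intCast_iff]
    rintro ⟨r, hr⟩; nlinarith [mul_self_nonneg r]
  · rw [show (11200 : ℚ) = ((11200 : ℕ) : ℚ) by norm_num, Rat.isSquare_natCast_iff]
    rintro ⟨r, hr⟩; exact Nat.not_exists_sq (m := 105) (by norm_num) (by norm_num) ⟨r, hr.symm⟩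
  · rw [show (560000 : ℚ) = ((560000 : ℕ) : ℚ) by norm_num, Rat.isSquare_natCast_iff]
    rintro ⟨r, hr⟩; exact Nat.not_exists_sq (m := 748) (by norm_num) (by norm_num) ⟨r, hr.symm⟩

/-- **`P₁₀ = (50, 400) ∉ 2E₁₀(ℚ) + E₁₀(ℚ)_tors`** (`α(P₁₀) = [50] ∉ {1, [11200]}`; `a² − 4b = −700`, `b = 11200` non-squares).
[cite: SilvermanTate2015, §3.5] -/
theorem fifty_ne_two_zsmul_add_E10 (R t : (⟨0, -210, 0, 11200, 0⟩ : WeierstrassCurve ℚ).toAffine.Point)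
    (ht : IsOfFinAddOrder t) : Affine.Point.some 50 400 nonsingular_E10_fifty ≠ (2 : ℤ) • R + t := by
  haveI := isElliptic_twoTorsionModel_neg_ten
  haveI : (⟨0, -210, 0, 11200, 0⟩ : WeierstrassCurve ℚ).IsTwoTorsionNF := ⟨rfl, rfl, rfl⟩
  obtain ⟨hD, hb, h560⟩ := not_isSquare_rat_anchor10
  have hD' : ¬ IsSquare ((⟨0, -210, 0, 11200, 0⟩ : WeierstrassCurve ℚ).a₂ ^ 2 -
      4 * (⟨0, -210, 0, 11200, 0⟩ : WeierstrassCurve ℚ).a₄) := by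
    rw [show (⟨0, -210, 0, 11200, 0⟩ : WeierstrassCurve ℚ).a₂ ^ 2 - 4 * (⟨0, -210, 0, 11200, 0⟩ : WeierstrassCurve ℚ).a₄
      = -700 by norm_num]; exact hD
  have h₂ : ¬ IsSquare ((50 : ℚ) * (⟨0, -210, 0, 11200, 0⟩ : WeierstrassCurve ℚ).a₄) := by
    rw [show (50 : ℚ) * (⟨0, -210, 0, 11200, 0⟩ : WeierstrassCurve ℚ).a₄ = 560000 by norm_num]; exact h560
  have h := some_ne_two_zsmul_add_of_not_isSquare _ hD' hb nonsingular_E10_fifty (by norm_num)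
    not_isSquare_rat_anchor5.2.2.1 h₂ R t (by convert ht)
  convert h

/-- **`P₁₀` has infinite order in `E₁₀(ℚ)`.** [cite: SilvermanTate2015, §3.5] -/
theorem not_isOfFinAddOrder_fifty_E10 : ¬ IsOfFinAddOrder
    (Affine.Point.some 50 400 nonsingular_E10_fifty : (⟨0, -210, 0, 11200, 0⟩ : WeierstrassCurve ℚ).toAffine.Point) := by
  intro hfin
  exact fifty_ne_two_zsmul_add_E10 0 _ hfin (by rw [zsmul_zero, zero_add])

/-- `E₁₀` is a model of `cm7^{(−10)} = cm7^{(−2·5)}`, in the shape the inert-two-twist descent consumes. [cite: SilvermanAEC2009, III.1 Table 3.1] -/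
theorem exists_smul_E10_eq_cm7_quadraticTwist_neg_ten :
    ∃ C₀ : VariableChange ℚ, C₀ • (⟨0, -210, 0, 11200, 0⟩ : WeierstrassCurve ℚ) = cm7.quadraticTwist ((-10 : ℤ) : ℚ) :=
  ⟨(⟨(Units.mk0 (2 : ℚ) two_ne_zero)⁻¹, -20, 0, 0⟩ : VariableChange ℚ)⁻¹, by
    rw [← twoTorsionChange_smul_cm7_quadraticTwist_neg_ten, inv_smul_smul]; norm_num⟩

/-- **`rank E₁₀(ℚ) ≤ 1`, and `= 1 ⇒ Ш(E₁₀/ℚ)[2] = 0`** (bsd-goldfeld's `rank_le_one_and_sha_two_inertTwoTwist` at `m = 5`).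
[cite: SilvermanAEC2009, Thm. X.4.2(a), Prop. X.4.9] -/
theorem rank_le_one_and_sha_two_E10 :
    haveI := isElliptic_twoTorsionModel_neg_ten
    (⟨0, -210, 0, 11200, 0⟩ : WeierstrassCurve ℚ).mordellWeilRank ≤ 1 ∧
      ((⟨0, -210, 0, 11200, 0⟩ : WeierstrassCurve ℚ).mordellWeilRank = 1 →
        ∀ c ∈ (⟨0, -210, 0, 11200, 0⟩ : WeierstrassCurve ℚ).sha, 2 • c = 0 → c = 0) := by
  haveI := isElliptic_twoTorsionModel_neg_ten
  obtain ⟨h0, hsq, hinert⟩ := inert_five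
  obtain ⟨C₀, hC₀⟩ := exists_smul_E10_eq_cm7_quadraticTwist_neg_ten
  exact rank_le_one_and_sha_two_inertTwoTwist (m := 5) h0 hsq hinert _ C₀ (by rw [hC₀]; norm_num)

/-- **`rank E₁₀(ℚ) = 1`**, UNCONDITIONAL. [cite: SilvermanAEC2009, Thm. VIII.6.7, Thm. X.4.2(a)] -/
theorem mordellWeilRank_E10 :
    haveI := isElliptic_twoTorsionModel_neg_ten
    (⟨0, -210, 0, 11200, 0⟩ : WeierstrassCurve ℚ).mordellWeilRank = 1 := by
  haveI := isElliptic_twoTorsionModel_neg_ten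
  refine le_antisymm rank_le_one_and_sha_two_E10.1 ?_
  refine one_le_mordellWeilRank_of_not_isOfFinAddOrder_rat _ (P := Affine.Point.some 50 400 nonsingular_E10_fifty) ?_
  convert not_isOfFinAddOrder_fifty_E10

/-- **`Ш(E₁₀/ℚ)[2] = 0`**, UNCONDITIONAL. [cite: SilvermanAEC2009, Thm. X.4.2(a), Prop. X.4.9] -/
theorem forall_mem_sha_two_E10 :
    haveI := isElliptic_twoTorsionModel_neg_ten
    ∀ c ∈ (⟨0, -210, 0, 11200, 0⟩ : WeierstrassCurve ℚ).sha, 2 • c = 0 → c = 0 :=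
  rank_le_one_and_sha_two_E10.2 mordellWeilRank_E10

/-- `Δ(E₁₀) = −1404928000000 = −2¹⁸·5⁶·7³` (kernel computation). [folklore] -/
theorem Δ_E10_int : (⟨0, -210, 0, 11200, 0⟩ : WeierstrassCurve ℤ).Δ = -1404928000000 := by decide

/-- **`E₁₀ = [0, −210, 0, 11200, 0]` is a GLOBAL MINIMAL MODEL** (Kraus at `2`: `2⁸ ∤ c₄ = 2⁶·2625`, `c₆ = 64·(−1323000)`,
`4 ∤ −1322999`; `ord_p Δ < 12` at odd `p`). [cite: Kraus1989, Prop. 2] [cite: SilvermanAEC2009, VII.1 Remark 1.1] -/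
theorem isGloballyMinimal_E10 : (⟨0, -210, 0, 11200, 0⟩ : WeierstrassCurve ℚ).IsGloballyMinimal := by
  obtain ⟨h4, h6⟩ := invariants_twoTorsionModel_neg_ten
  rw [twoTorsionModel_neg_ten_eq_baseChange]
  exact isGloballyMinimal_baseChange_int_of_kraus _ (by rw [h4]; decide) h6 (by decide)
    (fun p hp hp2 ↦ by rw [Δ_E10_int]; exact not_pow_twelve_dvd_of_odd_prime' hp hp2 (Or.inr rfl))

/-- **ANCHOR `d₀ = −10`, PART (a), assembled** (UNCONDITIONAL). [cite: SilvermanAEC2009, Thm. VIII.6.7, Thm. X.4.2(a)] [cite: Kraus1989, Prop. 2] -/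
theorem anchor_neg_ten_partA :
    haveI := isElliptic_twoTorsionModel_neg_ten
    (⟨0, -210, 0, 11200, 0⟩ : WeierstrassCurve ℚ).IsGloballyMinimal ∧
      (∃ C₀ : VariableChange ℚ, C₀ • (⟨0, -210, 0, 11200, 0⟩ : WeierstrassCurve ℚ) = cm7.quadraticTwist ((-10 : ℤ) : ℚ)) ∧
      (⟨0, -210, 0, 11200, 0⟩ : WeierstrassCurve ℚ).mordellWeilRank = 1 ∧
      (∀ c ∈ (⟨0, -210, 0, 11200, 0⟩ : WeierstrassCurve ℚ).sha, 2 • c = 0 → c = 0) :=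
  ⟨isGloballyMinimal_E10, exists_smul_E10_eq_cm7_quadraticTwist_neg_ten, mordellWeilRank_E10, forall_mem_sha_two_E10⟩

/-- **ANCHOR `d₀ = −10`, the shape of PART (b)** (same five prints + GZK; `r_an = 1` is bsd-goldfeld's
`analyticRank_eq_one_twist_cm7_neg10`): `r_an(E₁₀) = 1`, `Ш[2^∞] = 0`, `corank = 1`, **`BSD(E₁₀, 2) ⟺ ord₂ #Ш_an(E₁₀) = 0`**.
[cite: KrizLi2019, Thm. 1.20 (pp. 7–8)] [cite: Miller2011LMS, Def. 1.1] [cite: SilvermanAEC2009, Thm. X.4.2(a), Prop. X.4.9] -/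
theorem anchor_neg_ten_partB_shape (h120 : thm120_padicLogHeegner_unit_of_bernoulli)
    (hnf : exists_isNewformOf) (h12 : CoatesLiTianZhai2015.thm12_fullBSD_twist)
    (hGZ : ∀ (N : ℕ) [NeZero N] (W : WeierstrassCurve ℚ) (K : Type) [Field K] [NumberField K], gross_zagier N W K)
    (hHP : ∀ (W : WeierstrassCurve ℚ) (K : Type) [Field K] [NumberField K], exists_isHeegnerPoint W K)
    (hGZK : rank_eq_analyticRank_of_analyticRank_le_one) :
    haveI := isElliptic_twoTorsionModel_neg_ten
    (⟨0, -210, 0, 11200, 0⟩ : WeierstrassCurve ℚ).analyticRank = 1 ∧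
      AddCommGroup.primaryComponent (⟨0, -210, 0, 11200, 0⟩ : WeierstrassCurve ℚ).sha 2 = ⊥ ∧
      (⟨0, -210, 0, 11200, 0⟩ : WeierstrassCurve ℚ).selmerCorank 2 = 1 ∧
      (BSDp (⟨0, -210, 0, 11200, 0⟩ : WeierstrassCurve ℚ) 2 ↔
        ∃ q : ℚ, shaAn (⟨0, -210, 0, 11200, 0⟩ : WeierstrassCurve ℚ) = (q : ℂ) ∧ padicValRat 2 q = 0) := by
  haveI := isElliptic_twoTorsionModel_neg_ten
  obtain ⟨C₀, hC₀⟩ := exists_smul_E10_eq_cm7_quadraticTwist_neg_ten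
  have har := analyticRank_eq_one_twist_cm7_neg10 h120 hnf h12 hGZ hHP _ C₀ (by rw [hC₀]; norm_num)
  obtain ⟨h0, hsq, hinert⟩ := inert_five
  obtain ⟨-, hbot, hcork, hiff⟩ := bsdp_two_iff_shaAn_unit_inertTwoTwist hGZK (m := 5) h0 hsq hinert _ C₀
    (by rw [hC₀]; norm_num) har
  exact ⟨har, hbot, hcork, hiff⟩

end Summit.BirchSwinnertonDyer.BirchSwinnertonDyer.Theorems.PrintCf2.RubinValueTwoAnchor

end
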